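import Mathlib
import Literature.Analysis.FluidPDE.SpaceTimeCalculus
import Literature.Analysis.FluidPDE.VorticityTransportFormulaProofs
import Literature.Analysis.FluidPDE.AdditiveNoiseFlowDerivative
import Literature.Analysis.ODE.OneSidedComparison
import Summits.NavierStokesRegularity.NavierStokesRegularity.Theorems.TautLoopKelvinTautLoopLawStepWeberTools
import HarnessLib

/-!
# Route `TautLoopKelvin`, crux `TautLoopLaw` (stmt-NavierStokesRegularity-15249), line
  `Sketch-ideas-r1k1` (Dini–Saks architecture) — auxiliary tools stub `stub_tautLoopFlowTAux`
  serving the tools stub `stub_tautLoopStepFlowTaylorTools` (flow Taylor estimates)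

Quantitative Taylor expansion in `τ = b - s` of a *given* jointly smooth backward flow `X` of a
bounded smooth field `u` on a slab `[a, b] × E` (`b - a ≤ 1`): `∂ᵣ X(r, y) = u(r, X(r, y))`
within `[a, b]`, `X(b, ·) = id`, where `‖u‖ ≤ B₀`, `‖Du‖ ≤ B₁`, `‖D²u‖ ≤ B₂` and `u`, `Du` are
time-Lipschitz with constant `Bt`. This auxiliary file proves, for `s ∈ [a, b]`:

* `tautLoopFlowT_gronwall_back`: the backward linear Grönwall inequality on `[s, b]`;
* `tautLoopFlowT_disp`: `‖X(s, y) - y‖ ≤ B₀ τ` (mean value inequality along the trajectory);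
* `tautLoopFlowT_disp₂`: `‖X(s, y) - (y - τ u(b, y))‖ ≤ (B₁ B₀ + Bt) τ²` (the same for
  `r ↦ X(r, y) + (b - r) u(b, y)`, whose velocity `u(r, X(r, y)) - u(b, y)` is `O(b - r)`);
* `tautLoopFlowT_fderiv_apply_le`: `‖DX(s)(y) w‖ ≤ e^{B₁ τ} ‖w‖` — the first variational equation
  `J' = Du(r, X(r, y)) J` within `[a, b]` for `J(r) = DX(r)(y) w` (the tree's
  `hasDerivWithinAt_fderiv_flow_apply`), `J(b) = w`, and Grönwall backward from `b`;
* `tautLoopFlowT_fderiv_taylor`: `‖DX(s)(y) w - w + τ Du(b)(y) w‖ ≤ (B₁² + B₂ B₀ + Bt) e^{B₁} τ² ‖w‖`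
  — Grönwall for `H(r) = J(r) - w + (b - r) Du(b)(y) w`, `H(b) = 0`,
  `‖H'‖ ≤ B₁ ‖H‖ + (B₁² + B₂ B₀ + Bt)(b - r) ‖w‖`.

Everything is folklore ODE calculus (P. Hartman, *Ordinary Differential Equations* (1964), Ch. V,
Thm. 3.1 and Cor. 3.1: differentiability of solutions in the initial point and the variational
equation; the Grönwall inequality of Ch. III, Thm. 1.1). The helpers are stated over a (complete)
real normed space; the last theorem packages the four estimates on `ℝ³` as the registered
auxiliary tools stub.
-/

noncomputable section

open Set Function Filter Topology
open Literature.Analysis.FluidPDE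

namespace Summit.NavierStokesRegularity.NavierStokesRegularity.Theorems

set_option linter.dupNamespace false

variable {E : Type*} [NormedAddCommGroup E] [NormedSpace ℝ E]

/-! ### Backward Grönwall on `[s, b]` -/

/-- Backward linear Grönwall inequality on `[s, b]`: if `‖e'‖ ≤ K ‖e‖ + C` on `[s, b]`
(derivatives within `[s, b]`, `K, C ≥ 0`), then `‖e(s)‖ ≤ (‖e(b)‖ + C (b - s)) e^{K (b - s)}`
(two-sided Grönwall from the end-point `b`, and `gronwallBound δ K C x ≤ (δ + C x) e^{K x}`). [folklore] -/
theorem tautLoopFlowT_gronwall_back {e e' : ℝ → E} {K C s b : ℝ} (hsb : s ≤ b)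
    (he : ∀ r ∈ Icc s b, HasDerivWithinAt e (e' r) (Icc s b) r)
    (hb : ∀ r ∈ Icc s b, ‖e' r‖ ≤ K * ‖e r‖ + C) (hK : 0 ≤ K) (hC : 0 ≤ C) :
    ‖e s‖ ≤ (‖e b‖ + C * (b - s)) * Real.exp (K * (b - s)) := by
  have h := Torus.norm_le_gronwallBound_two_sided he hb (right_mem_Icc.2 hsb)
    (left_mem_Icc.2 hsb)
  rw [abs_of_nonpos (sub_nonpos.2 hsb), neg_sub] at h
  exact h.trans (Literature.Analysis.ODE.gronwallBound_le_mul_exp hC hK)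

/-! ### Taylor estimates for a given backward flow -/

section Flow

variable {a b : ℝ} {u X : ℝ → E → E} {B₀ B₁ B₂ Bt : ℝ}

/-- **Displacement to first order**: `‖X(s, y) - y‖ ≤ B₀ (b - s)` along a trajectory of speed
`≤ B₀` ending at `X(b, y) = y` (mean value inequality on `[s, b]`). [folklore] -/
theorem tautLoopFlowT_disp
    (hXu : ∀ s ∈ Icc a b, ∀ y, HasDerivWithinAt (fun r => X r y) (u s (X s y)) (Icc a b) s)
    (hXb : ∀ y, X b y = y) (hB₀ : ∀ s ∈ Icc a b, ∀ x, ‖u s x‖ ≤ B₀) {s : ℝ} (hs : s ∈ Icc a b)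
    (y : E) : ‖X s y - y‖ ≤ B₀ * (b - s) := by
  have hsub : Icc s b ⊆ Icc a b := Icc_subset_Icc hs.1 le_rfl
  have hder : ∀ r ∈ Icc s b, HasDerivWithinAt (fun r => X r y) (u r (X r y)) (Icc s b) r :=
    fun r hr => (hXu r (hsub hr) y).mono hsub
  have h := norm_image_sub_le_of_norm_deriv_le_segment' hder
    (fun r hr => hB₀ r (hsub (Ico_subset_Icc_self hr)) _) b (right_mem_Icc.2 hs.2)
  rwa [hXb, norm_sub_rev] at h

/-- **Displacement to second order**: `‖X(s, y) - (y - (b - s) u(b, y))‖ ≤ (B₁ B₀ + Bt) (b - s)²`: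
the curve `r ↦ X(r, y) + (b - r) u(b, y)` has velocity `u(r, X(r, y)) - u(b, y)`, of norm
`≤ B₁ ‖X(r, y) - y‖ + Bt (b - r) ≤ (B₁ B₀ + Bt)(b - s)` on `[s, b]`. [folklore] -/
theorem tautLoopFlowT_disp₂ (hu : IsSmoothSpaceTimeOn (Icc a b) u)
    (hXu : ∀ s ∈ Icc a b, ∀ y, HasDerivWithinAt (fun r => X r y) (u s (X s y)) (Icc a b) s)
    (hXb : ∀ y, X b y = y) (hB₀ : ∀ s ∈ Icc a b, ∀ x, ‖u s x‖ ≤ B₀)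
    (hB₁ : ∀ s ∈ Icc a b, ∀ x, ‖fderiv ℝ (u s) x‖ ≤ B₁)
    (hut : ∀ s ∈ Icc a b, ∀ s' ∈ Icc a b, ∀ x, ‖u s' x - u s x‖ ≤ Bt * |s' - s|)
    (h₀ : 0 ≤ B₀) (h₁ : 0 ≤ B₁) (ht : 0 ≤ Bt) {s : ℝ} (hs : s ∈ Icc a b) (y : E) :
    ‖X s y - (y - (b - s) • u b y)‖ ≤ (B₁ * B₀ + Bt) * (b - s) ^ 2 := by
  have hb : b ∈ Icc a b := right_mem_Icc.2 (hs.1.trans hs.2)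
  have hsub : Icc s b ⊆ Icc a b := Icc_subset_Icc hs.1 le_rfl
  -- the curve `g r = X r y + (b - r) • u b y` and its velocity
  have hder : ∀ r ∈ Icc s b, HasDerivWithinAt (fun r => X r y + (b - r) • u b y)
      (u r (X r y) - u b y) (Icc s b) r := by
    intro r hr
    have h1 : HasDerivWithinAt (fun r : ℝ => (b - r) • u b y) ((-1 : ℝ) • u b y) (Icc s b) r :=
      ((hasDerivWithinAt_id r _).const_sub b).smul_const (u b y)
    refine (((hXu r (hsub hr) y).mono hsub).add h1).congr_deriv ?_
    rw [neg_one_smul, sub_eq_add_neg]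
  have hbound : ∀ r ∈ Ico s b, ‖u r (X r y) - u b y‖ ≤ (B₁ * B₀ + Bt) * (b - s) := by
    intro r hr
    have hr' : r ∈ Icc a b := hsub (Ico_subset_Icc_self hr)
    have hdiff : Differentiable ℝ (u r) := (hu.contDiff_slice hr').differentiable (by simp)
    have e1 : ‖u r (X r y) - u r y‖ ≤ B₁ * ‖X r y - y‖ :=
      convex_univ.norm_image_sub_le_of_norm_fderiv_le (fun x _ => hdiff x)
        (fun x _ => hB₁ r hr' x) (mem_univ y) (mem_univ (X r y))
    have e2 : ‖u r y - u b y‖ ≤ Bt * |r - b| := hut b hb r hr' y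
    rw [abs_of_nonpos (by linarith [hr.2]), neg_sub] at e2
    have e3 : ‖X r y - y‖ ≤ B₀ * (b - r) := tautLoopFlowT_disp hXu hXb hB₀ hr' y
    have hbr : b - r ≤ b - s := by linarith [hr.1]
    have hbr0 : 0 ≤ b - r := by linarith [hr.2]
    calc ‖u r (X r y) - u b y‖ = ‖(u r (X r y) - u r y) + (u r y - u b y)‖ := by
          rw [sub_add_sub_cancel]
      _ ≤ ‖u r (X r y) - u r y‖ + ‖u r y - u b y‖ := norm_add_le _ _
      _ ≤ B₁ * (B₀ * (b - r)) + Bt * (b - r) := add_le_add (e1.trans (by gcongr)) e2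
      _ = (B₁ * B₀ + Bt) * (b - r) := by ring
      _ ≤ (B₁ * B₀ + Bt) * (b - s) := by gcongr
  have h := norm_image_sub_le_of_norm_deriv_le_segment' hder hbound b (right_mem_Icc.2 hs.2)
  rw [hXb, sub_self, zero_smul, add_zero] at h
  calc ‖X s y - (y - (b - s) • u b y)‖ = ‖y - (X s y + (b - s) • u b y)‖ := by
        rw [← norm_neg]; congr 1; abel
    _ ≤ (B₁ * B₀ + Bt) * (b - s) * (b - s) := h
    _ = (B₁ * B₀ + Bt) * (b - s) ^ 2 := by ring

/-- **First variation, a priori bound**: `‖DX(s)(y) w‖ ≤ e^{B₁ (b - s)} ‖w‖` — the first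
variational equation `J' = Du(r, X(r, y)) J` within `[a, b]` for `J(r) = DX(r)(y) w`, `J(b) = w`,
and Grönwall backward from `b`. [folklore] -/
theorem tautLoopFlowT_fderiv_apply_le [CompleteSpace E] (hab : a < b)
    (hu : IsSmoothSpaceTimeOn (Icc a b) u) (hX : IsSmoothSpaceTimeOn (Icc a b) X)
    (hXu : ∀ s ∈ Icc a b, ∀ y, HasDerivWithinAt (fun r => X r y) (u s (X s y)) (Icc a b) s)
    (hXb : ∀ y, X b y = y) (hB₁ : ∀ s ∈ Icc a b, ∀ x, ‖fderiv ℝ (u s) x‖ ≤ B₁) (h₁ : 0 ≤ B₁)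
    {s : ℝ} (hs : s ∈ Icc a b) (y w : E) :
    ‖fderiv ℝ (X s) y w‖ ≤ Real.exp (B₁ * (b - s)) * ‖w‖ := by
  have hU : UniqueDiffOn ℝ (Icc a b) := uniqueDiffOn_Icc hab
  have hsub : Icc s b ⊆ Icc a b := Icc_subset_Icc hs.1 le_rfl
  have hder : ∀ r ∈ Icc s b, HasDerivWithinAt (fun r => fderiv ℝ (X r) y w)
      (fderiv ℝ (u r) (X r y) (fderiv ℝ (X r) y w)) (Icc s b) r := fun r hr =>
    (hasDerivWithinAt_fderiv_flow_apply hu hX hU hXu (hsub hr) y w).mono hsub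
  have hbd : ∀ r ∈ Icc s b, ‖fderiv ℝ (u r) (X r y) (fderiv ℝ (X r) y w)‖ ≤
      B₁ * ‖fderiv ℝ (X r) y w‖ + 0 := fun r hr => by
    rw [add_zero]
    exact (fderiv ℝ (u r) (X r y)).le_of_opNorm_le (hB₁ r (hsub hr) _) _
  have h := tautLoopFlowT_gronwall_back hs.2 hder hbd h₁ le_rfl
  have hXb' : X b = id := funext hXb
  have e0 : fderiv ℝ (X b) y w = w := by simp [hXb']
  rw [e0, zero_mul, add_zero] at h
  rwa [mul_comm] at h

/-- **First variation to second order**: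
`‖DX(s)(y) w - w + (b - s) Du(b)(y) w‖ ≤ (B₁² + B₂ B₀ + Bt) e^{B₁} (b - s)² ‖w‖` — Grönwall for
`H(r) = J(r) - w + (b - r) Du(b)(y) w`, `H(b) = 0`, whose derivative
`Du(r, X) J - Du(b, y) w = Du(r, X)(J - w) + (Du(r, X(r, y)) - Du(r, y)) w + (Du(r, y) - Du(b, y)) w`
has norm `≤ B₁ ‖H‖ + (B₁² + B₂ B₀ + Bt)(b - r) ‖w‖`. [folklore] -/
theorem tautLoopFlowT_fderiv_taylor [CompleteSpace E] (hab : a < b) (hba : b - a ≤ 1)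
    (hu : IsSmoothSpaceTimeOn (Icc a b) u) (hX : IsSmoothSpaceTimeOn (Icc a b) X)
    (hXu : ∀ s ∈ Icc a b, ∀ y, HasDerivWithinAt (fun r => X r y) (u s (X s y)) (Icc a b) s)
    (hXb : ∀ y, X b y = y) (hB₀ : ∀ s ∈ Icc a b, ∀ x, ‖u s x‖ ≤ B₀)
    (hB₁ : ∀ s ∈ Icc a b, ∀ x, ‖fderiv ℝ (u s) x‖ ≤ B₁)
    (hB₂ : ∀ s ∈ Icc a b, ∀ x, ‖iteratedFDeriv ℝ 2 (u s) x‖ ≤ B₂)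
    (hDut : ∀ s ∈ Icc a b, ∀ s' ∈ Icc a b, ∀ x,
      ‖fderiv ℝ (u s') x - fderiv ℝ (u s) x‖ ≤ Bt * |s' - s|)
    (h₀ : 0 ≤ B₀) (h₁ : 0 ≤ B₁) (h₂ : 0 ≤ B₂) (ht : 0 ≤ Bt) {s : ℝ} (hs : s ∈ Icc a b)
    (y w : E) :
    ‖fderiv ℝ (X s) y w - w + (b - s) • fderiv ℝ (u b) y w‖ ≤
      (B₁ ^ 2 + B₂ * B₀ + Bt) * Real.exp B₁ * (b - s) ^ 2 * ‖w‖ := by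
  have hU : UniqueDiffOn ℝ (Icc a b) := uniqueDiffOn_Icc hab
  have hb : b ∈ Icc a b := right_mem_Icc.2 hab.le
  have hsub : Icc s b ⊆ Icc a b := Icc_subset_Icc hs.1 le_rfl
  have hτ0 : 0 ≤ b - s := sub_nonneg.2 hs.2
  have hτ1 : b - s ≤ 1 := by linarith [hs.1]
  set A : E →L[ℝ] E := fderiv ℝ (u b) y with hA
  -- the derivative of `H`
  have hder : ∀ r ∈ Icc s b, HasDerivWithinAt (fun r => fderiv ℝ (X r) y w - w + (b - r) • A w)
      (fderiv ℝ (u r) (X r y) (fderiv ℝ (X r) y w) - A w) (Icc s b) r := by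
    intro r hr
    have h1 : HasDerivWithinAt (fun r : ℝ => (b - r) • A w) ((-1 : ℝ) • A w) (Icc s b) r :=
      ((hasDerivWithinAt_id r _).const_sub b).smul_const (A w)
    have h2 := (((hasDerivWithinAt_fderiv_flow_apply hu hX hU hXu (hsub hr) y w).mono
      hsub).sub_const w).add h1
    refine h2.congr_deriv ?_
    rw [neg_one_smul, sub_eq_add_neg]
  -- the linear differential inequality for `H`
  have hbd : ∀ r ∈ Icc s b, ‖fderiv ℝ (u r) (X r y) (fderiv ℝ (X r) y w) - A w‖ ≤
      B₁ * ‖fderiv ℝ (X r) y w - w + (b - r) • A w‖ +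
        (B₁ ^ 2 + B₂ * B₀ + Bt) * (b - s) * ‖w‖ := by
    intro r hr
    have hr' : r ∈ Icc a b := hsub hr
    have hbr : b - r ≤ b - s := by linarith [hr.1]
    have hbr0 : 0 ≤ b - r := by linarith [hr.2]
    set J : E := fderiv ℝ (X r) y w with hJ
    set D : E →L[ℝ] E := fderiv ℝ (u r) (X r y) with hD
    set D₀ : E →L[ℝ] E := fderiv ℝ (u r) y with hD₀
    have hdec : D J - A w =
        (D (J - w + (b - r) • A w) - (b - r) • D (A w)) + (D - D₀) w + (D₀ - A) w := by
      simp only [map_sub, map_add, map_smul, sub_apply]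
      abel
    have hAw : ‖A w‖ ≤ B₁ * ‖w‖ := A.le_of_opNorm_le (hB₁ b hb y) w
    have e1 : ‖D (J - w + (b - r) • A w)‖ ≤ B₁ * ‖J - w + (b - r) • A w‖ :=
      D.le_of_opNorm_le (hB₁ r hr' _) _
    have e1' : ‖(b - r) • D (A w)‖ ≤ (b - r) * (B₁ * (B₁ * ‖w‖)) := by
      rw [norm_smul, Real.norm_of_nonneg hbr0]
      gcongr
      exact (D.le_of_opNorm_le (hB₁ r hr' _) _).trans (by gcongr)
    have e2 : ‖(D - D₀) w‖ ≤ B₂ * (B₀ * (b - r)) * ‖w‖ := by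
      refine ((D - D₀).le_opNorm w).trans ?_
      gcongr
      calc ‖D - D₀‖ ≤ B₂ * ‖X r y - y‖ :=
            tautLoopWeber_norm_fderiv_sub_le ((hu.contDiff_slice hr').of_le (by norm_cast))
              (hB₂ r hr') y (X r y)
        _ ≤ B₂ * (B₀ * (b - r)) := by gcongr; exact tautLoopFlowT_disp hXu hXb hB₀ hr' y
    have e3 : ‖(D₀ - A) w‖ ≤ Bt * (b - r) * ‖w‖ := by
      refine ((D₀ - A).le_opNorm w).trans ?_
      gcongr
      have := hDut b hb r hr' y
      rwa [abs_of_nonpos (by linarith [hr.2]), neg_sub] at this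
    calc ‖D J - A w‖
        = ‖(D (J - w + (b - r) • A w) - (b - r) • D (A w)) + (D - D₀) w + (D₀ - A) w‖ := by
          rw [hdec]
      _ ≤ ‖D (J - w + (b - r) • A w) - (b - r) • D (A w)‖ + ‖(D - D₀) w‖ + ‖(D₀ - A) w‖ :=
          norm_add₃_le
      _ ≤ (‖D (J - w + (b - r) • A w)‖ + ‖(b - r) • D (A w)‖) + ‖(D - D₀) w‖ + ‖(D₀ - A) w‖ := by
          gcongr; exact norm_sub_le _ _
      _ ≤ (B₁ * ‖J - w + (b - r) • A w‖ + (b - r) * (B₁ * (B₁ * ‖w‖))) +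
            B₂ * (B₀ * (b - r)) * ‖w‖ + Bt * (b - r) * ‖w‖ :=
          add_le_add_three (add_le_add e1 e1') e2 e3
      _ = B₁ * ‖J - w + (b - r) • A w‖ + (B₁ ^ 2 + B₂ * B₀ + Bt) * (b - r) * ‖w‖ := by ring
      _ ≤ B₁ * ‖J - w + (b - r) • A w‖ + (B₁ ^ 2 + B₂ * B₀ + Bt) * (b - s) * ‖w‖ := by gcongr
  have h := tautLoopFlowT_gronwall_back hs.2 hder hbd h₁ (by positivity)
  have hXb' : X b = id := funext hXb
  have e0 : fderiv ℝ (X b) y w - w + (b - b) • A w = 0 := by simp [hXb']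
  rw [e0, norm_zero, zero_add] at h
  calc ‖fderiv ℝ (X s) y w - w + (b - s) • A w‖
      ≤ (B₁ ^ 2 + B₂ * B₀ + Bt) * (b - s) * ‖w‖ * (b - s) * Real.exp (B₁ * (b - s)) := h
    _ ≤ (B₁ ^ 2 + B₂ * B₀ + Bt) * (b - s) * ‖w‖ * (b - s) * Real.exp B₁ := by
      gcongr; exact mul_le_of_le_one_right h₁ hτ1
    _ = (B₁ ^ 2 + B₂ * B₀ + Bt) * Real.exp B₁ * (b - s) ^ 2 * ‖w‖ := by ring

end Flow

/-! ### The registered auxiliary tools stub -/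

/-- **Auxiliary tools stub `stub_tautLoopFlowTAux`**: the four estimates above (displacement to
first and second order, a priori bound and second-order expansion of the first variation),
specialised to `ℝ³`. [folklore] -/
theorem stub_tautLoopFlowTAux : (∀ (u X : ℝ → EuclideanSpace ℝ (Fin 3) → EuclideanSpace ℝ (Fin 3))
    (a b B₀ : ℝ), (∀ s ∈ Set.Icc a b, ∀ y, HasDerivWithinAt (fun r => X r y) (u s (X s y))
    (Set.Icc a b) s) → (∀ y, X b y = y) → (∀ s ∈ Set.Icc a b, ∀ x, ‖u s x‖ ≤ B₀) →
    ∀ s ∈ Set.Icc a b, ∀ y, ‖X s y - y‖ ≤ B₀ * (b - s)) ∧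
    (∀ (u X : ℝ → EuclideanSpace ℝ (Fin 3) → EuclideanSpace ℝ (Fin 3)) (a b B₀ B₁ Bt : ℝ),
    Literature.Analysis.FluidPDE.IsSmoothSpaceTimeOn (Set.Icc a b) u →
    (∀ s ∈ Set.Icc a b, ∀ y, HasDerivWithinAt (fun r => X r y) (u s (X s y)) (Set.Icc a b) s) →
    (∀ y, X b y = y) → (∀ s ∈ Set.Icc a b, ∀ x, ‖u s x‖ ≤ B₀) →
    (∀ s ∈ Set.Icc a b, ∀ x, ‖fderiv ℝ (u s) x‖ ≤ B₁) →
    (∀ s ∈ Set.Icc a b, ∀ s' ∈ Set.Icc a b, ∀ x, ‖u s' x - u s x‖ ≤ Bt * |s' - s|) →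
    0 ≤ B₀ → 0 ≤ B₁ → 0 ≤ Bt →
    ∀ s ∈ Set.Icc a b, ∀ y, ‖X s y - (y - (b - s) • u b y)‖ ≤ (B₁ * B₀ + Bt) * (b - s) ^ 2) ∧
    (∀ (u X : ℝ → EuclideanSpace ℝ (Fin 3) → EuclideanSpace ℝ (Fin 3)) (a b B₁ : ℝ), a < b →
    Literature.Analysis.FluidPDE.IsSmoothSpaceTimeOn (Set.Icc a b) u →
    Literature.Analysis.FluidPDE.IsSmoothSpaceTimeOn (Set.Icc a b) X →
    (∀ s ∈ Set.Icc a b, ∀ y, HasDerivWithinAt (fun r => X r y) (u s (X s y)) (Set.Icc a b) s) →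
    (∀ y, X b y = y) → (∀ s ∈ Set.Icc a b, ∀ x, ‖fderiv ℝ (u s) x‖ ≤ B₁) → 0 ≤ B₁ →
    ∀ s ∈ Set.Icc a b, ∀ y w, ‖fderiv ℝ (X s) y w‖ ≤ Real.exp (B₁ * (b - s)) * ‖w‖) ∧
    (∀ (u X : ℝ → EuclideanSpace ℝ (Fin 3) → EuclideanSpace ℝ (Fin 3)) (a b B₀ B₁ B₂ Bt : ℝ),
    a < b → b - a ≤ 1 → Literature.Analysis.FluidPDE.IsSmoothSpaceTimeOn (Set.Icc a b) u →
    Literature.Analysis.FluidPDE.IsSmoothSpaceTimeOn (Set.Icc a b) X →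
    (∀ s ∈ Set.Icc a b, ∀ y, HasDerivWithinAt (fun r => X r y) (u s (X s y)) (Set.Icc a b) s) →
    (∀ y, X b y = y) → (∀ s ∈ Set.Icc a b, ∀ x, ‖u s x‖ ≤ B₀) →
    (∀ s ∈ Set.Icc a b, ∀ x, ‖fderiv ℝ (u s) x‖ ≤ B₁) →
    (∀ s ∈ Set.Icc a b, ∀ x, ‖iteratedFDeriv ℝ 2 (u s) x‖ ≤ B₂) →
    (∀ s ∈ Set.Icc a b, ∀ s' ∈ Set.Icc a b, ∀ x,
      ‖fderiv ℝ (u s') x - fderiv ℝ (u s) x‖ ≤ Bt * |s' - s|) →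
    0 ≤ B₀ → 0 ≤ B₁ → 0 ≤ B₂ → 0 ≤ Bt → ∀ s ∈ Set.Icc a b, ∀ y w,
    ‖fderiv ℝ (X s) y w - w + (b - s) • fderiv ℝ (u b) y w‖ ≤
      (B₁ ^ 2 + B₂ * B₀ + Bt) * Real.exp B₁ * (b - s) ^ 2 * ‖w‖) :=
  ⟨fun _u _X _a _b _B₀ hXu hXb hB₀ _s hs y => tautLoopFlowT_disp hXu hXb hB₀ hs y,
    fun _u _X _a _b _B₀ _B₁ _Bt hu hXu hXb hB₀ hB₁ hut h₀ h₁ ht _s hs y =>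
      tautLoopFlowT_disp₂ hu hXu hXb hB₀ hB₁ hut h₀ h₁ ht hs y,
    fun _u _X _a _b _B₁ hab hu hX hXu hXb hB₁ h₁ _s hs y w =>
      tautLoopFlowT_fderiv_apply_le hab hu hX hXu hXb hB₁ h₁ hs y w,
    fun _u _X _a _b _B₀ _B₁ _B₂ _Bt hab hba hu hX hXu hXb hB₀ hB₁ hB₂ hDut h₀ h₁ h₂ ht _s hs y w =>
      tautLoopFlowT_fderiv_taylor hab hba hu hX hXu hXb hB₀ hB₁ hB₂ hDut h₀ h₁ h₂ ht hs y w⟩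

end Summit.NavierStokesRegularity.NavierStokesRegularity.Theorems

end
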